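import Summits.RiemannHypothesis.RiemannHypothesis.Theorems.HandoffHardyRigiditySimpleZeros
import Summits.RiemannHypothesis.RiemannHypothesis.Theorems.HandoffHarmonicDivides
import HarnessLib

/-!
# HANDOFF — the Hardy-rigidity DICTIONARY assembled: value version = divisibility version + simple zeros (file XX-d)

Cell `rh-explicit`, TRACK «HANDOFF» (ROUTE 1′), seat theory-1 (H-T, statement owner), gen18. RH-free; assembles
XX-b `HandoffHardyRigiditySimpleZeros` (p388886) and XX-c `HandoffHarmonicDivides` (p388722 ACCEPTED 3b55cc778833);
no new analysis, no definitions (the combined draft theory-1/HandoffHardyRigidity.combined-all-draft.lean, rc 0, is the pre-build evidence). idea-3 g25's predicates (HOME `handoff/idea-3/g25/lean/HandoffHardyRigidity.lean`,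
not in the tree) are written out verbatim: `GaussTail 2 v` = `∃ C, ∀ t, ‖v t‖ ≤ C(1+e^{2|t|})² e^{|t|/2 − πe^{2|t|}}`;
`IsWeilHarmonic v` = `∀ g, IsWeilTest g → weilFunctional (weilConv v (weilReflect g)) = 0`; `XiDivides v` =
`∃ m, Differentiable ℂ m ∧ ∀ s, weilMellin v s = m s * riemannXi s`; `MellinLadder 2 v` = `∃ P : ℂ[X], (∀ k, 2 ≤ k+1 →
P.coeff k = 0) ∧ ∀ s, weilMellin v s = P.eval s * riemannXi s`; `HRigValue 2` / `HRig 2` / `HarmonicDivides 2` the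
corresponding `∀ v, Measurable v → GaussTail 2 v → … → …` statements.

* `simple_zeros_iff` — «`ξ′(ρ) ≠ 0` at every non-trivial zero» ⟺ `SimpleZerosConjecture` (`ξ′ = A·ζ′`, `A ≠ 0`).
* `xiDivides_imp_harmonic` — on the measurable rate-`π` class, `ξ ∣ v̂` ⟹ Weil-harmonic, UNCONDITIONALLY
  (values: `v̂(ρ) = m(ρ)·0`; XX-b's `harmonic_of_weilMellin_eq_zero'` with XX-c's exponential moments).
* **`harmonicDivides_two_iff_simple_zeros`** — idea-3 g25's bridge `HarmonicDivides 2` ⟺ simple zeros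
  (⟸ XX-c `harmonicDivides_two_of_simple_zeros`; ⟹ XX-b `not_harmonicDivides_two_of_multiple_zero`).
* **`hRigValue_two_iff_hRig_two_and_simple_zeros`** — THE PLACEMENT IN ONE LINE:
  **`HRigValue 2` ⟺ `HRig 2` ∧ «simple zeros»** — the lemma offered by idea-3 g24 (Hardy rigidity over the
  HARMONIC predicate) is EXACTLY the classical, SZC-free divisibility lemma `HRig 2` (g25; Hardy 1933 / BDJ 2003 /
  route B″ — untouched in the tree) PLUS the Simple Zeros Conjecture. `…_iff_…simpleZerosConjecture` restates both
  with the tree's `SimpleZerosConjecture`.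
* `hRigValue_forces_simple_zeros` — the value version forces simple zeros at EVERY order `D ≥ 2` (idea-3 g25's
  `HRigValue D` unfolded; the witness has the order-2, hence order-`D`, tail and a polynomial quotient is continuous).

Neither of SZC, RH is known to imply the other; nothing here bears on the truth of RH (LOGIC-CARD item 4⁗′,
HANDOFF-STATEMENT §J.33/§J.33′).
-/

set_option linter.dupNamespace false  -- the mandated namespace repeats `RiemannHypothesis`

noncomputable section

open Set Filter MeasureTheory Complex
open scoped Topology Real
open Literature.NumberTheory.LFunctions
open Summit.RiemannHypothesis.RiemannHypothesis.Theorems.GroundStatesConvergeToXi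
open Summit.RiemannHypothesis.RiemannHypothesis.Theorems.HandoffHarmonicDivides

namespace Summit.RiemannHypothesis.RiemannHypothesis.Theorems.HandoffHardyRigidity

/-- «`ξ′(ρ) ≠ 0` at every non-trivial zero `ρ`» ⟺ the tree's `SimpleZerosConjecture` («`ζ′(ρ) ≠ 0`»):
`ξ′(ρ) = A(ρ)·ζ′(ρ)` at a zero with `A(ρ) ≠ 0` (`deriv_riemannXi_eq_of_zero`, `xiFactor_ne_zero`). [folklore] -/
theorem simple_zeros_iff :
    (∀ ρ : ℂ, ρ ∈ ZetaZeros.riemannZetaNontrivialZeros → deriv riemannXi ρ ≠ 0) ↔ SimpleZerosConjecture := by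
  have key : ∀ ρ : ℂ, ρ ∈ ZetaZeros.riemannZetaNontrivialZeros →
      (deriv riemannXi ρ ≠ 0 ↔ deriv riemannZeta ρ ≠ 0) := by
    intro ρ hρ
    obtain ⟨hζ, h0, -⟩ := mem_riemannZetaNontrivialZeros_iff_holds.1 hρ
    have hne1 : ρ ≠ 1 := ZetaZeros.riemannZetaNontrivialZeros.ne_one hρ
    rw [Literature.Barriers.RiemannHypothesis.deriv_riemannXi_eq_of_zero h0 hne1 hζ,
      mul_ne_zero_iff, and_iff_right (Literature.Barriers.RiemannHypothesis.xiFactor_ne_zero h0 hne1)]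
  exact ⟨fun h ρ hρ => (key ρ hρ).1 (h ρ hρ), fun h ρ hρ => (key ρ hρ).2 (h ρ hρ)⟩

/-- **`ξ ∣ v̂` ⟹ Weil-harmonic, unconditionally**, for a measurable `v` with the order-2 rate-`π` tail: `v̂ = m·ξ`
vanishes on the non-trivial zero set (values), and the dictionary `harmonic_of_weilMellin_eq_zero'` applies on the
weighted class (exponential moments from the tail, XX-c). So idea-3 g25's `HRigValue 2` ⟹ `HRig 2`. [folklore] -/
theorem xiDivides_imp_harmonic {v : ℝ → ℂ} (hm : Measurable v) {C : ℝ}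
    (hv : ∀ t, ‖v t‖ ≤ C * (1 + Real.exp (2 * |t|)) ^ 2 * Real.exp (|t| / 2 - π * Real.exp (2 * |t|)))
    (hdiv : ∃ m : ℂ → ℂ, Differentiable ℂ m ∧ ∀ s : ℂ, weilMellin v s = m s * riemannXi s)
    {g : ℝ → ℂ} (hg : IsWeilTest g) : weilFunctional (weilConv v (weilReflect g)) = 0 := by
  obtain ⟨m, -, hvm⟩ := hdiv
  exact harmonic_of_weilMellin_eq_zero' hm.aestronglyMeasurable (by norm_num : (1:ℝ) / 2 < 3 / 4)
    (integrable_norm_mul_exp_of_gaussTail hm.aestronglyMeasurable hv (3 / 4))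
    (fun ρ hρ => by rw [hvm ρ, riemannXi_eq_zero_of_mem_riemannZetaNontrivialZeros hρ, mul_zero]) hg

/-- **THE BRIDGE IS EXACTLY SIMPLE ZEROS**: idea-3 g25's `HarmonicDivides 2` (unfolded verbatim) ⟺ «`ξ′(ρ) ≠ 0` at
every non-trivial zero» (⟸ XX-c; ⟹ XX-b's witness at a multiple zero). [folklore] -/
theorem harmonicDivides_two_iff_simple_zeros :
    (∀ v : ℝ → ℂ, Measurable v →
      (∃ C : ℝ, ∀ t : ℝ,
        ‖v t‖ ≤ C * (1 + Real.exp (2 * |t|)) ^ 2 * Real.exp (|t| / 2 - π * Real.exp (2 * |t|))) →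
      (∀ g : ℝ → ℂ, IsWeilTest g → weilFunctional (weilConv v (weilReflect g)) = 0) →
      ∃ m : ℂ → ℂ, Differentiable ℂ m ∧ ∀ s : ℂ, weilMellin v s = m s * riemannXi s) ↔
    ∀ ρ : ℂ, ρ ∈ ZetaZeros.riemannZetaNontrivialZeros → deriv riemannXi ρ ≠ 0 :=
  ⟨fun H _ hρ hξ' => not_harmonicDivides_two_of_multiple_zero
      (ZetaZeros.riemannZetaNontrivialZeros.re_pos hρ) (ZetaZeros.riemannZetaNontrivialZeros.re_lt_one hρ)
      (riemannXi_eq_zero_of_mem_riemannZetaNontrivialZeros hρ) hξ' H,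
    harmonicDivides_two_of_simple_zeros⟩

/-- **THE PLACEMENT IN ONE LINE: `HRigValue 2` ⟺ `HRig 2` ∧ «simple zeros»** (idea-3 g25's statements unfolded
verbatim). The value-level Hardy rigidity offered by idea-3 g24 (over the HARMONIC predicate) is exactly the
classical divisibility-level lemma `HRig 2` (hypothesis `ξ ∣ v̂`; SZC-free, untouched in the tree) PLUS the
simplicity of every non-trivial zero: (⟹) simple zeros by XX-b, and `HRig 2` because `ξ ∣ v̂` ⟹ harmonic
(`xiDivides_imp_harmonic`); (⟸) harmonic ⟹ `ξ ∣ v̂` under simple zeros (XX-c), then `HRig 2`. [folklore] -/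
theorem hRigValue_two_iff_hRig_two_and_simple_zeros :
    (∀ v : ℝ → ℂ, Measurable v →
      (∃ C : ℝ, ∀ t : ℝ,
        ‖v t‖ ≤ C * (1 + Real.exp (2 * |t|)) ^ 2 * Real.exp (|t| / 2 - π * Real.exp (2 * |t|))) →
      (∀ g : ℝ → ℂ, IsWeilTest g → weilFunctional (weilConv v (weilReflect g)) = 0) →
      ∃ P : Polynomial ℂ, (∀ k : ℕ, 2 ≤ k + 1 → P.coeff k = 0) ∧
        ∀ s : ℂ, weilMellin v s = P.eval s * riemannXi s) ↔
    ((∀ v : ℝ → ℂ, Measurable v →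
      (∃ C : ℝ, ∀ t : ℝ,
        ‖v t‖ ≤ C * (1 + Real.exp (2 * |t|)) ^ 2 * Real.exp (|t| / 2 - π * Real.exp (2 * |t|))) →
      (∃ m : ℂ → ℂ, Differentiable ℂ m ∧ ∀ s : ℂ, weilMellin v s = m s * riemannXi s) →
      ∃ P : Polynomial ℂ, (∀ k : ℕ, 2 ≤ k + 1 → P.coeff k = 0) ∧
        ∀ s : ℂ, weilMellin v s = P.eval s * riemannXi s) ∧
    ∀ ρ : ℂ, ρ ∈ ZetaZeros.riemannZetaNontrivialZeros → deriv riemannXi ρ ≠ 0) := by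
  constructor
  · intro H
    refine ⟨fun v hm htail hdiv => ?_, fun _ hρ => hRigValue_two_forces_simple_zeros H hρ⟩
    obtain ⟨C, hv⟩ := htail
    exact H v hm ⟨C, hv⟩ (fun g hg => xiDivides_imp_harmonic hm hv hdiv hg)
  · rintro ⟨H, hS⟩ v hm htail hharm
    exact H v hm htail (harmonicDivides_two_of_simple_zeros hS v hm htail hharm)

/-- The same placement with the tree's `SimpleZerosConjecture`: **`HRigValue 2` ⟺ `HRig 2` ∧ SimpleZerosConjecture**.
[folklore] -/
theorem hRigValue_two_iff_hRig_two_and_simpleZerosConjecture :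
    (∀ v : ℝ → ℂ, Measurable v →
      (∃ C : ℝ, ∀ t : ℝ,
        ‖v t‖ ≤ C * (1 + Real.exp (2 * |t|)) ^ 2 * Real.exp (|t| / 2 - π * Real.exp (2 * |t|))) →
      (∀ g : ℝ → ℂ, IsWeilTest g → weilFunctional (weilConv v (weilReflect g)) = 0) →
      ∃ P : Polynomial ℂ, (∀ k : ℕ, 2 ≤ k + 1 → P.coeff k = 0) ∧
        ∀ s : ℂ, weilMellin v s = P.eval s * riemannXi s) ↔
    ((∀ v : ℝ → ℂ, Measurable v →
      (∃ C : ℝ, ∀ t : ℝ,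
        ‖v t‖ ≤ C * (1 + Real.exp (2 * |t|)) ^ 2 * Real.exp (|t| / 2 - π * Real.exp (2 * |t|))) →
      (∃ m : ℂ → ℂ, Differentiable ℂ m ∧ ∀ s : ℂ, weilMellin v s = m s * riemannXi s) →
      ∃ P : Polynomial ℂ, (∀ k : ℕ, 2 ≤ k + 1 → P.coeff k = 0) ∧
        ∀ s : ℂ, weilMellin v s = P.eval s * riemannXi s) ∧
    SimpleZerosConjecture) := by
  rw [hRigValue_two_iff_hRig_two_and_simple_zeros, simple_zeros_iff]

/-- idea-3 g25's bridge with the tree's conjecture: `HarmonicDivides 2` ⟺ `SimpleZerosConjecture`. [folklore] -/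
theorem harmonicDivides_two_iff_simpleZerosConjecture :
    (∀ v : ℝ → ℂ, Measurable v →
      (∃ C : ℝ, ∀ t : ℝ,
        ‖v t‖ ≤ C * (1 + Real.exp (2 * |t|)) ^ 2 * Real.exp (|t| / 2 - π * Real.exp (2 * |t|))) →
      (∀ g : ℝ → ℂ, IsWeilTest g → weilFunctional (weilConv v (weilReflect g)) = 0) →
      ∃ m : ℂ → ℂ, Differentiable ℂ m ∧ ∀ s : ℂ, weilMellin v s = m s * riemannXi s) ↔
    SimpleZerosConjecture := by
  rw [harmonicDivides_two_iff_simple_zeros, simple_zeros_iff]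

/-! ## All orders `D ≥ 2` -/

/-- The order-2 tail bound implies the order-`D` one for every `D ≥ 2` (`1 + e^{2|t|} ≥ 1`). [folklore] -/
theorem gaussTail_of_two_le {v : ℝ → ℂ} {C : ℝ}
    (hv : ∀ t, ‖v t‖ ≤ C * (1 + Real.exp (2 * |t|)) ^ 2 * Real.exp (|t| / 2 - π * Real.exp (2 * |t|)))
    {D : ℕ} (hD : 2 ≤ D) :
    ∃ C' : ℝ, ∀ t, ‖v t‖ ≤ C' * (1 + Real.exp (2 * |t|)) ^ D * Real.exp (|t| / 2 - π * Real.exp (2 * |t|)) := by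
  refine ⟨|C|, fun t => (hv t).trans ?_⟩
  have h1 : (1 : ℝ) ≤ 1 + Real.exp (2 * |t|) := by linarith [Real.exp_pos (2 * |t|)]
  have hpow : (1 + Real.exp (2 * |t|)) ^ 2 ≤ (1 + Real.exp (2 * |t|)) ^ D := pow_le_pow_right₀ h1 hD
  calc C * (1 + Real.exp (2 * |t|)) ^ 2 * Real.exp (|t| / 2 - π * Real.exp (2 * |t|))
      ≤ |C| * (1 + Real.exp (2 * |t|)) ^ 2 * Real.exp (|t| / 2 - π * Real.exp (2 * |t|)) := by
        gcongr; exact le_abs_self C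
    _ ≤ |C| * (1 + Real.exp (2 * |t|)) ^ D * Real.exp (|t| / 2 - π * Real.exp (2 * |t|)) := by gcongr

/-- **idea-3 g25's `HRigValue D` forces simple zeros for EVERY order `D ≥ 2`** (unfolded verbatim: measurable +
order-`D` rate-`π` tail + Weil-harmonic ⟹ `v̂ = P·ξ`, `P.coeff k = 0` for `D ≤ k + 1`): the witness of XX-b has
the order-2 (hence order-`D`) tail and `v̂/ξ` has a pole, while a polynomial quotient is continuous
(`not_exists_continuous_quotient`). So the value-level Hardy rigidity is ≥ SZC at every order, not only at
`D = 2`. [folklore] -/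
theorem hRigValue_forces_simple_zeros {D : ℕ} (hD : 2 ≤ D)
    (H : ∀ v : ℝ → ℂ, Measurable v →
      (∃ C : ℝ, ∀ t : ℝ,
        ‖v t‖ ≤ C * (1 + Real.exp (2 * |t|)) ^ D * Real.exp (|t| / 2 - π * Real.exp (2 * |t|))) →
      (∀ g : ℝ → ℂ, IsWeilTest g → weilFunctional (weilConv v (weilReflect g)) = 0) →
      ∃ P : Polynomial ℂ, (∀ k : ℕ, D ≤ k + 1 → P.coeff k = 0) ∧
        ∀ s : ℂ, weilMellin v s = P.eval s * riemannXi s)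
    {ρ : ℂ} (hρ : ρ ∈ ZetaZeros.riemannZetaNontrivialZeros) : deriv riemannXi ρ ≠ 0 := by
  intro hξ'
  have h0 := ZetaZeros.riemannZetaNontrivialZeros.re_pos hρ
  have h1 := ZetaZeros.riemannZetaNontrivialZeros.re_lt_one hρ
  have hξ := riemannXi_eq_zero_of_mem_riemannZetaNontrivialZeros hρ
  obtain ⟨v, hcd, -, -, ⟨C, htail⟩, hharm, hkey, -, -⟩ :=
    exists_harmonic_gaussTail_not_const_mul_phi h0 h1 hξ hξ'
  obtain ⟨P, -, hvP⟩ := H v hcd.continuous.measurable (gaussTail_of_two_le htail hD) hharm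
  exact not_exists_continuous_quotient h0 h1 hξ hkey
    ⟨fun s => P.eval s, P.continuous.continuousAt, fun s _ _ => hvP s⟩

end Summit.RiemannHypothesis.RiemannHypothesis.Theorems.HandoffHardyRigidity

end
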